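import Summits.QuantumFields.YangMills.Theorems.UV3UnitPartitionLowerOfPackage
import Summits.QuantumFields.YangMills.Theorems.AlphaInputsT3ACv3Pint
import Literature.MathematicalPhysics.QuantumFieldTheory.Balaban1983to89.T3MinimiserStabilityReduction
import HarnessLib

/-!
# S-low‴ — THE (47)-HALF OF THE UNIT ENVELOPE `exp(−E_K − Cl) ≤ Z_K`, K-UNIFORM, **CLOSED MODULO THE v3 (α) PACKAGE** `AlphaInputsT3AC.OfV3At`
# (no displayed window row left: (46) `PintSize`, the [7] minimiser membership `uminTriv`, `χ_K = 1`, (47) a.e., the remainder size are ALL the v3 datum's theorems)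

Cell `ym3-torus` (YM ladder rung R3 = continuum `SU(2)` Yang–Mills on the three-torus — a RUNG, NOT d = 4, NOT infinite volume, NOT a mass gap,
NOT Clay).  Width seat `ym3-torus-px12` (gen 12; p1-lineage purpose = the UV3 node of [Balaban1985UV3]); `--supports stmt-QuantumFields-19936 --as helper`,
count-neutral, definition-free, default heartbeats.  ★★OWNER RECORD 17aq: R-19936-U `stub_unitEnvelope` = (U)-half [the resummation organ at the trivial pin]
+ (L)-half; ✓`UV3UnitPartitionLowerOfPackage` (p746059) typed the (L)-half modulo the v1 package WITH two displayed window rows (`hMain`, `hPint`).  For the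
v3 package of the lane (`AlphaInputsT3ACv3*`: `OfV3At F 𝔠 a₀ a₁`, datum `dataT3v3`) BOTH rows are theorems of the tree — (46) `dataT3v3_pintSize` (via
`Balaban3D.Proofs.Bound46AC`) and the [Balaban1985Variational] Thm 1 membership `dataT3v3_uminTriv` — so here the (L)-half CLOSES modulo the package and two
SMALLNESS rows on the unit-scale threshold `θBal(0)` against the [7] radii `a₀, a₁` (dischargeable by the `γ₁` of `stub_unitEnvelope`'s prefix, since
`θBal(0) = √γ·p(√γ) → 0`):
* ★ `exp_Ecst_le_partitionFn_of_rows` — GENERIC over a datum `D : AlphaDataT3 F γ`: (47)_K a.e. + `χ_K = 1` on the window + `Rm_K ≤ CR` + window bounds on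
  `mainT_K(triv)` and `Pint_K(triv)` (all for `K ≥ 1`) ⟹ `∃ Cl, ∀ K ≥ 1, exp(−D.Ecst K K − Cl) ≤ ∫ρ_K` (✓p744493 §3's K-uniform window volume);
* ★ `exp_neg_le_partitionFn_zero` — the run `K = 0` (no renormalisation step): `exp(−2β₀·#Plaq(T₁)) ≤ Z₀` (`A ≤ 2·#Plaq`, Haar a probability);
* ★★★ `exp_Ecst_le_partitionFn_of_packageV3` — under `h : OfV3At F 𝔠 a₀ a₁`, `hc`, `γ ∈ (0, (min γ₀ 1)²]`, `π`, and `θBal(0) ≤ a₁`, `B₃·θBal(0) ≤ a₀`: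
  **`∃ Cl, ∀ K, exp(−(h.dataT3v3 …).Ecst K K − Cl) ≤ ∫ V, emlDensity F γ K K V ∂dV_K`** — every row of the generic theorem discharged BY NAME:
  `dataT3v3_ineq47AE`, `dataT3v3_chi_eq_one_of_plaqSmall`, `dataT3v3_rmSize` (+ lit `exp_two_Rm_le`∕`Rm_nonneg`), `dataT3v3_mainTermIsAction` + `dataT3v3_uminTriv`
  (at height `0`, radius `ε₀ := B₃·θBal(0)`) + ✓`beta_mul_wilsonAction4_le_of_regFibrePr` (`β_K·A ≤ 12ε₀²L^{3m}∕γ`, K-free), `dataT3v3_pintSize` + `dataT3v3_admOnSmall`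
  (`|Pint_K(triv)| ≤ C46·M₁³·θBal(1)²·(2L^m)³`), `PkgAtV3.θBal_pos`; the `K = 0` run by `exp_neg_le_partitionFn_zero` (`Ecst 0 0 = 0`, `dataT3v3_Ecst_eq`).
With ✓`unitEnvelope_of_halves` (p746059 §4) this is the `hL` input of R-19936-U at the anchor `E K := Ecst K K`; the `hU` input is R-19936-S's organ.

HONEST SCOPE.  Bookkeeping over the v3 package's landed rows; CONDITIONAL on `AlphaInputsT3AC.OfV3At F 𝔠 a₀ a₁` (the UV3 node's (α) inputs, v3 edition — a
hypothesis schema, «closed modulo inputs») and the two smallness rows; nothing of Theorem 1's upper half, `stub_pinnedStep`, `stub_unitEnvelope` itself, `hP`,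
`HistoryTailL` (19936) or the rung is proved here.  Sorry-free, axioms standard.

References: T. Bałaban, Commun. Math. Phys. **102** (1985) 255–275 [Balaban1985UV3] ((1)–(6) pp.256–257, (11) p.258, (41) p.266, (46)–(47) p.267, (64) p.273);
Commun. Math. Phys. **102** (1985) 277–309 [Balaban1985Variational] (Thm 1 (6)–(8) pp.278–279).
-/

set_option autoImplicit false

noncomputable section

namespace Summit.QuantumFields.YangMills.Theorems.UV3UnitPartitionLowerOfPackageV3

open MeasureTheory
open Literature.MathematicalPhysics.QuantumFieldTheory.Balaban1983to89
open Literature.MathematicalPhysics.QuantumFieldTheory.Balaban1983to89.T3ContinuumYM3Torus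
open Literature.MathematicalPhysics.QuantumFieldTheory.Balaban1983to89.T3UnitLawDensityEML (ℰp emlDensity emlDensity_zero integrable_emlDensity)
open Literature.MathematicalPhysics.QuantumFieldTheory.Balaban1983to89.T3UnitScaleTilt (θBal)
open Literature.MathematicalPhysics.QuantumFieldTheory.Balaban1983to89.T3RestrictedUnitDensity (resDensity)
open Literature.MathematicalPhysics.QuantumFieldTheory.Balaban1983to89.T3LevelShift (fieldShift fieldShift_symm_fieldShift)
open Literature.MathematicalPhysics.QuantumFieldTheory.Balaban1983to89.T3AlphaInputsAC
open Literature.MathematicalPhysics.QuantumFieldTheory.Balaban1983to89.Missing (boltzmann isProbabilityMeasure_fieldMeasure)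
open Literature.MathematicalPhysics.QuantumFieldTheory.Balaban1985CMP102
open Literature.MathematicalPhysics.QuantumFieldTheory.Balaban1985CMP102.Setting
open Summit.QuantumFields.Balaban3D.Carriers
open Summit.QuantumFields.Balaban3D.Proofs.Primitives
open Summit.QuantumFields.YangMills.Theorems.UV3PartitionLowerOfWindow (exp_le_integral_emlDensity_top_of_plaqSmall_floor_ae)
open Summit.QuantumFields.YangMills.Theorems.UV3UnitPartitionLowerOfPackage (resDensity_univ_eq beta_mul_wilsonAction4_le_of_regFibrePr)

/-! ## §1 Generic: the window rows of a datum integrate to the K-uniform lower bound (runs `K ≥ 1`) -/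

/-- ★ **ROWS ⟹ `exp(−E_K − Cl) ≤ Z_K` (runs `K ≥ 1`)**, for ANY datum `D : AlphaDataT3 F γ`: (47)_K a.e., `χ_K = 1` on the window `{PlaqSmall θBal(0)}` of `T₁^{(K)}`,
a K-uniform bound on the remainder `Rm_K`, and K-uniform window bounds on the trivial-history main term and interaction sum give ONE `Cl` with
`exp(−D.Ecst K K − Cl) ≤ ∫ρ_K dV_K` for every `K ≥ 1` (the window volume is ✓`exp_le_integral_emlDensity_top_of_plaqSmall_floor_ae`).
[cite: Balaban1985UV3, (47) p.267, (5)–(6) pp.256–257] -/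
theorem exp_Ecst_le_partitionFn_of_rows (F : T3Family) {γ : ℝ} (hγ : 0 < γ) (D : AlphaDataT3 F γ) (b₀ p₀ : ℝ)
    (hθ : 0 < θBal F.L γ b₀ p₀ 0)
    (h47 : ∀ K : ℕ, 1 ≤ K → Ineq47AE D K K)
    (hχ : ∀ (K : ℕ) (W : GaugeField (F.P K) K (Matrix.specialUnitaryGroup (Fin 2) ℂ)), 1 ≤ K →
      PlaqSmall (θBal F.L γ b₀ p₀ 0) W → D.χ K K W = 1)
    (hRm : ∃ CR : ℝ, ∀ K : ℕ, 1 ≤ K → D.Rm K K ≤ CR)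
    (hMain : ∃ Cm : ℝ, ∀ (K : ℕ) (W : GaugeField (F.P K) K (Matrix.specialUnitaryGroup (Fin 2) ℂ)), 1 ≤ K →
      PlaqSmall (θBal F.L γ b₀ p₀ 0) W → D.mainT K K (D.triv K K) W ≤ Cm)
    (hPint : ∃ CP : ℝ, ∀ (K : ℕ) (W : GaugeField (F.P K) K (Matrix.specialUnitaryGroup (Fin 2) ℂ)), 1 ≤ K →
      PlaqSmall (θBal F.L γ b₀ p₀ 0) W → -CP ≤ D.Pint K K (D.triv K K) W) :
    ∃ Cl : ℝ, ∀ K : ℕ, 1 ≤ K →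
      Real.exp (-(D.Ecst K K) - Cl) ≤ ∫ V, emlDensity F γ K K V ∂fieldMeasure (F.P K) K (Matrix.specialUnitaryGroup (Fin 2) ℂ) := by
  obtain ⟨CR, hCR⟩ := hRm
  obtain ⟨Cm, hCm⟩ := hMain
  obtain ⟨CP, hCP⟩ := hPint
  obtain ⟨Cv, hCv⟩ := exp_le_integral_emlDensity_top_of_plaqSmall_floor_ae F hγ.le hθ
  refine ⟨CR + Cm + CP + Cv, fun K hK => ?_⟩
  have hfloor : ∀ᵐ W ∂fieldMeasure (F.P K) K (Matrix.specialUnitaryGroup (Fin 2) ℂ),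
      PlaqSmall (θBal F.L γ b₀ p₀ 0) W → Real.exp (-(D.Ecst K K + CR + Cm + CP)) ≤ emlDensity F γ K K W := by
    filter_upwards [h47 K hK] with W hW hsmall
    have hlow : D.low K K W = Real.exp (-(D.mainT K K (D.triv K K) W) + D.Pint K K (D.triv K K) W) := by
      unfold AlphaDataT3.low
      rw [hχ K W hK hsmall, one_mul]
    have hm := hCm K W hK hsmall
    have hp := hCP K W hK hsmall
    have hr := hCR K hK
    rw [← resDensity_univ_eq F γ K K]
    refine le_trans ?_ hW
    rw [hlow, ← Real.exp_add]
    exact Real.exp_le_exp.mpr (by linarith)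
  have hint := hCv K (D.Ecst K K + CR + Cm + CP) hfloor
  have e : -(D.Ecst K K) - (CR + Cm + CP + Cv) = -(D.Ecst K K + CR + Cm + CP + Cv) := by ring
  rw [e]
  exact hint

/-! ## §2 The run `K = 0`: no renormalisation step, `Z₀ ≥ exp(−2β₀·#Plaq)` -/

/-- ★ **THE RUN `K = 0`**: `ρ₀ = e^{−β₀A}` with `A ≤ 2·#Plaq(T₁)` and product Haar a probability measure, so `exp(−2β₀·#Plaq) ≤ ∫ρ₀ = Z₀`.
[cite: Balaban1985UV3, (1) p.256 and (6) p.257] -/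
theorem exp_neg_le_partitionFn_zero (F : T3Family) {γ : ℝ} (hγ : 0 ≤ γ) :
    Real.exp (-(2 * (F.scheme ℰp γ).β 0 * Fintype.card (Plaq (F.P 0) 0))) ≤
      ∫ V, emlDensity F γ 0 0 V ∂fieldMeasure (F.P 0) 0 (Matrix.specialUnitaryGroup (Fin 2) ℂ) := by
  haveI := isProbabilityMeasure_fieldMeasure (G := Matrix.specialUnitaryGroup (Fin 2) ℂ) (F.P 0) 0
  have hβ : 0 ≤ (F.scheme ℰp γ).β 0 := F.scheme_β_nonneg ℰp hγ 0
  have hpt : ∀ V : GaugeField (F.P 0) 0 (Matrix.specialUnitaryGroup (Fin 2) ℂ),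
      Real.exp (-(2 * (F.scheme ℰp γ).β 0 * Fintype.card (Plaq (F.P 0) 0))) ≤ emlDensity F γ 0 0 V := by
    intro V
    rw [emlDensity_zero]
    show _ ≤ boltzmann (F.P 0) ((F.scheme ℰp γ).β 0) V
    unfold boltzmann
    refine Real.exp_le_exp.mpr ?_
    have hA := T3MinimiserStabilityReduction.wilsonAction4_le_two_mul_card (G := Matrix.specialUnitaryGroup (Fin 2) ℂ) V
    nlinarith [hA, hβ]
  calc Real.exp (-(2 * (F.scheme ℰp γ).β 0 * Fintype.card (Plaq (F.P 0) 0)))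
      = ∫ _V, Real.exp (-(2 * (F.scheme ℰp γ).β 0 * Fintype.card (Plaq (F.P 0) 0)))
          ∂fieldMeasure (F.P 0) 0 (Matrix.specialUnitaryGroup (Fin 2) ℂ) := by
        rw [integral_const, smul_eq_mul, probReal_univ, one_mul]
    _ ≤ ∫ V, emlDensity F γ 0 0 V ∂fieldMeasure (F.P 0) 0 (Matrix.specialUnitaryGroup (Fin 2) ℂ) :=
        integral_mono (integrable_const _) (integrable_emlDensity F 0 hγ 0 (Nat.zero_le _)) hpt

/-! ## §3 The v3 package: every row discharged -/

variable {F : T3Family} {𝔠 : AlphaConsts F.L (suGroupModel 2).N} {a₀ a₁ : ℝ}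

/-- ★★★ **S-low‴ — `exp(−E_K − Cl) ≤ Z_K` FOR EVERY RUN `K`, ONE `Cl`, MODULO THE v3 (α) PACKAGE ONLY** (plus the two smallness rows of the unit-scale threshold
against the [7] radii).  Rows of §1 BY NAME from the v3 datum's theorems: (47) `dataT3v3_ineq47AE`; `χ_K = 1` `dataT3v3_chi_eq_one_of_plaqSmall`; remainder
`dataT3v3_rmSize`; main term `dataT3v3_mainTermIsAction` + the [7] membership `dataT3v3_uminTriv` at height `0`, radius `ε₀ := B₃·θBal(0)`, + ✓`beta_mul_wilsonAction4_le_of_regFibrePr`;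
interaction `dataT3v3_pintSize` ((46)) + `dataT3v3_admOnSmall`; `K = 0` by §2 with `Ecst 0 0 = 0` (`dataT3v3_Ecst_eq`).
[cite: Balaban1985UV3, (5)–(6) pp.256–257, (46)–(47) p.267, (64) p.273; Balaban1985Variational, Thm 1 (8) p.279] -/
theorem exp_Ecst_le_partitionFn_of_packageV3 (h : AlphaInputsT3AC.OfV3At F 𝔠 a₀ a₁) (hc : 0 < a₀ ∧ 0 < a₁ ∧ 𝔠.B₃ * a₁ ≤ a₀)
    (γ : ℝ) (hγ : 0 < γ) (hγ1 : γ ≤ (min 𝔠.gamma0 1) ^ 2) (π : AlphaInputsT3AC.PolymerT3 F)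
    (ha₁ : θBal F.L γ 𝔠.b₀ 𝔠.p₀ 0 ≤ a₁) (ha₀ : 𝔠.B₃ * θBal F.L γ 𝔠.b₀ 𝔠.p₀ 0 ≤ a₀) :
    ∃ Cl : ℝ, ∀ K : ℕ,
      Real.exp (-((h.dataT3v3 hc γ hγ hγ1 π).Ecst K K) - Cl) ≤
        ∫ V, emlDensity F γ K K V ∂fieldMeasure (F.P K) K (Matrix.specialUnitaryGroup (Fin 2) ℂ) := by
  set D := h.dataT3v3 hc γ hγ hγ1 π with hD
  have hL1 : (1 : ℝ) < F.L := by exact_mod_cast F.hL.2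
  have hθ : 0 < θBal F.L γ 𝔠.b₀ 𝔠.p₀ 0 := by
    have := (h.pkgAtV3 hc γ hγ hγ1 0).θBal_pos 0 le_rfl
    simpa using this
  -- (47) a.e. and χ = 1 on the window
  have h47 : ∀ K : ℕ, 1 ≤ K → Ineq47AE D K K := fun K _ => h.dataT3v3_ineq47AE hc γ hγ hγ1 π K K le_rfl
  have hχ : ∀ (K : ℕ) (W : GaugeField (F.P K) K (Matrix.specialUnitaryGroup (Fin 2) ℂ)), 1 ≤ K →
      PlaqSmall (θBal F.L γ 𝔠.b₀ 𝔠.p₀ 0) W → D.χ K K W = 1 := by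
    intro K W _ hW
    exact h.dataT3v3_chi_eq_one_of_plaqSmall hc γ hγ hγ1 π K K le_rfl W (by simpa using hW)
  -- the remainder: `Rm_K ≤ log CRm`
  have hRm : ∃ CR : ℝ, ∀ K : ℕ, 1 ≤ K → D.Rm K K ≤ CR := by
    obtain ⟨CRm, hCRm⟩ := exp_two_Rm_le (h.dataT3v3_rmSize hc γ hγ hγ1 π)
    have hCRm0 : 0 < CRm := (Real.exp_pos _).trans_le (hCRm 0 0 le_rfl)
    refine ⟨Real.log CRm, fun K _ => ?_⟩
    have h0 : 0 ≤ D.Rm K K := Rm_nonneg (h.dataT3v3_rmSize hc γ hγ hγ1 π) le_rfl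
    have h2 : Real.exp (2 * D.Rm K K) ≤ CRm := hCRm K K le_rfl
    have h1 : Real.exp (D.Rm K K) ≤ Real.exp (2 * D.Rm K K) := Real.exp_le_exp.mpr (by linarith)
    exact (Real.le_log_iff_exp_le hCRm0).mpr (h1.trans h2)
  -- the main term on the window: [7] membership at height 0 + the K-free action bound
  have hMain : ∃ Cm : ℝ, ∀ (K : ℕ) (W : GaugeField (F.P K) K (Matrix.specialUnitaryGroup (Fin 2) ℂ)), 1 ≤ K →
      PlaqSmall (θBal F.L γ 𝔠.b₀ 𝔠.p₀ 0) W → D.mainT K K (D.triv K K) W ≤ Cm := by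
    refine ⟨12 * (𝔠.B₃ * θBal F.L γ 𝔠.b₀ 𝔠.p₀ 0) ^ 2 * (F.L : ℝ) ^ (3 * F.m) / γ, fun K W hK hW => ?_⟩
    -- read `W` as the shift of a unit-lattice field `V` of run `0`
    have hsp := F.sitesPerDir_eq (m := F.m) (K := K) (j := K - 0) (m' := F.m) (K' := 0) (j' := 0) (by omega)
    set V : GaugeField (F.P 0) 0 (Matrix.specialUnitaryGroup (Fin 2) ℂ) := fieldShift hsp.symm W with hVdef
    have hWV : fieldShift hsp V = W := fieldShift_symm_fieldShift hsp W
    have hV : PlaqSmall (θBal F.L γ 𝔠.b₀ 𝔠.p₀ 0) V := by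
      rw [← hWV] at hW
      exact (T3CruxEstimates.plaqSmall_fieldShift F hsp _ V).mp hW
    have hu := h.dataT3v3_uminTriv hc γ hγ hγ1 π K 0 (by omega) (𝔠.B₃ * θBal F.L γ 𝔠.b₀ 𝔠.p₀ 0) ha₁ le_rfl ha₀ V hV
    have hb := beta_mul_wilsonAction4_le_of_regFibrePr F hγ (𝔠.B₃ * θBal F.L γ 𝔠.b₀ 𝔠.p₀ 0) K V hu.1
    rw [h.dataT3v3_mainTermIsAction hc γ hγ hγ1 π K K (D.triv K K) W]
    rw [hWV] at hb
    exact hb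
  -- the interaction sum on the window: (46) at `j = K ≥ 1` + admissibility of the trivial history
  have hPint : ∃ CP : ℝ, ∀ (K : ℕ) (W : GaugeField (F.P K) K (Matrix.specialUnitaryGroup (Fin 2) ℂ)), 1 ≤ K →
      PlaqSmall (θBal F.L γ 𝔠.b₀ 𝔠.p₀ 0) W → -CP ≤ D.Pint K K (D.triv K K) W := by
    refine ⟨𝔠.C46 * (𝔠.M₁ : ℝ) ^ 3 * θBal F.L γ 𝔠.b₀ 𝔠.p₀ 1 ^ 2 * ((2 * F.L ^ F.m : ℕ) : ℝ) ^ 3, fun K W hK hW => ?_⟩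
    have hW' : PlaqSmall (θBal F.L γ 𝔠.b₀ 𝔠.p₀ (K - K)) W := by simpa using hW
    have hadm := h.dataT3v3_admOnSmall hc γ hγ hγ1 π K K W le_rfl hW'
    have h46 := h.dataT3v3_pintSize hc γ hγ hγ1 π K K (D.triv K K) W le_rfl hK hadm
    have hsites : ((F.P K).sitesPerDir K : ℝ) = ((2 * F.L ^ F.m : ℕ) : ℝ) := by
      have : (F.P K).sitesPerDir K = 2 * F.L ^ F.m := by simp [Params.sitesPerDir]
      rw [this]
    have hKK : K - K + 1 = 1 := by omega
    rw [hKK, hsites] at h46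
    have := (abs_le.mp h46).1
    linarith
  obtain ⟨Cl₁, hCl₁⟩ := exp_Ecst_le_partitionFn_of_rows F hγ D 𝔠.b₀ 𝔠.p₀ hθ h47 hχ hRm hMain hPint
  -- combine with the run K = 0
  set Cl₀ : ℝ := 2 * (F.scheme ℰp γ).β 0 * Fintype.card (Plaq (F.P 0) 0) with hCl₀
  refine ⟨max Cl₁ Cl₀, fun K => ?_⟩
  rcases Nat.eq_zero_or_pos K with hK0 | hKpos
  · subst hK0
    have hE : D.Ecst 0 0 = 0 := by
      rw [h.dataT3v3_Ecst_eq hc γ hγ hγ1 π 0 0 le_rfl]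
      simp
    rw [hE, neg_zero, zero_sub]
    refine le_trans (Real.exp_le_exp.mpr ?_) (exp_neg_le_partitionFn_zero F hγ.le)
    rw [← hCl₀]
    exact neg_le_neg (le_max_right _ _)
  · refine le_trans (Real.exp_le_exp.mpr ?_) (hCl₁ K hKpos)
    linarith [le_max_left Cl₁ Cl₀]

end Summit.QuantumFields.YangMills.Theorems.UV3UnitPartitionLowerOfPackageV3

end
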